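import Summits.QuantumFields.YangMills.Theorems.SwapTwistDeficitSheetTrial
import Literature.Analysis.FunctionSpaces.BMOCarlesonDuality
import HarnessLib

/-!
# The Polyakov SIGN witness `O = sign(polDist − polDist∘S)`: a bounded swap-odd physical bit, and the pointwise persistence inequality
# `O(U)O(V) ≥ 1 − 2·𝟙[|polDist U − polDist (S U)| ≤ 2Lt] − 2·𝟙[some link of (U,V) is t-far]`

Support module for the trace-door cruxes `SlowBitWindow.StepPersistence` (stmt-QuantumFields-23271) and `SwapTwistDeficit.TwistDeficitLaplaceWindow`
(stmt-QuantumFields-23776, the Laplace window W of LINE g11-A) of seat ym-idea-4.  The companion door module reduces BOTH, on a window `L ≤ β^a`,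
to ONE thermal small-ball estimate for the pair (x-Polyakov holonomy, y-Polyakov holonomy) through the origin; this file supplies the witness and
the deterministic half of the argument (no measure theory beyond measurability):

* §1 (`Real.sign` measurability / bound are the tree's `Literature.Analysis.FunctionSpaces.BMOInv.measurable_real_sign` /
  `abs_real_sign_le_one`) `isPhys_polDist`, `isPhys_signWitness`, `abs_signWitness_le_one`, `signWitness_swap`: `O U = sign(polDist U − polDist (S U))`
  (`S = configPerm (swap 0 1)`, `polDist` = Hilbert–Schmidt distance of the `x`-Polyakov holonomy through the origin to the centre, module
  `…SwapTwistDeficitFlatSheetDefs`) is physical (gauge and centre-twist invariant, measurable), `|O| ≤ 1`, and swap-ODD;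
* §2 `signWitness_mul_eq_one`, `one_sub_le_signWitness_mul`: if `|polDist U − polDist (S U)| > 2Lt` and every link of `V` is within `t` of the
  corresponding link of `U` (Frobenius norm), then `O U · O V = 1` (`polDist` and `polDist∘S` are `L·t`-Lipschitz along such pairs); hence for ALL `U, V`:
  `O U · O V ≥ 1 − 2·𝟙_{strip(2Lt)}(U) − 2·𝟙_{far(t)}(U,V)`;
* §3 `transferKernel_mul_indicator_far_le`: on the far event the transfer kernel is exponentially small, `K_β(U,V)·𝟙_{far(t)}(U,V) ≤ e^{β(2|E| − t²/2)}`
  (`transferKernel_le_of_far_link`).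

HONEST FRAMING: fixed-lattice bookkeeping for a reduction (door), not a proof of any crux; no semiclassics/RG; nothing about infinite volume, the
continuum limit or the Clay Yang–Mills gap.  No `sorry`, no new axiom, no new definition (the witness is written as an explicit lambda).
References: [cite: MadrasSokal1988, §2]; [cite: Luscher1983, §2]; [cite: SeilerLNP1982, §3].
-/

set_option autoImplicit false

noncomputable section

open MeasureTheory Filter Topology Real Function
open scoped Matrix ComplexConjugate BigOperators
open Literature.MathematicalPhysics.QuantumLattice
open Literature.MathematicalPhysics.QuantumFieldTheory hiding SU2
open Summit.QuantumFields.YangMills.Theorems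

namespace Summit.QuantumFields.YangMills.Theorems.FemtoTransferGap.FlatSheet

open Summit.QuantumFields.YangMills.Theorems.FemtoTransferGap

variable {L : ℕ}

/-! ## §1 The sign witness is a bounded swap-odd physical bit -/

/-- Two reals closer to each other than the first is to `0` have the same sign, so the product of their signs is `1`. [folklore] -/
theorem real_sign_mul_sign_eq_one {x y d : ℝ} (hxy : |x - y| ≤ d) (hx : d < |x|) : Real.sign x * Real.sign y = 1 := by
  rcases lt_trichotomy x 0 with hx0 | hx0 | hx0
  · have hy : y < 0 := by
      have h1 : |x| = -x := abs_of_neg hx0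
      have h2 := (abs_sub_comm x y ▸ hxy)
      have h3 : y - x ≤ |y - x| := le_abs_self _
      linarith
    rw [Real.sign_of_neg hx0, Real.sign_of_neg hy]; norm_num
  · exfalso; rw [hx0, abs_zero] at hx; linarith [abs_nonneg (x - y)]
  · have hy : 0 < y := by
      have h1 : |x| = x := abs_of_pos hx0
      have h3 : x - y ≤ |x - y| := le_abs_self _
      linarith
    rw [Real.sign_of_pos hx0, Real.sign_of_pos hy]; norm_num

/-- `polDist` itself is a physical zero-flux test function (continuous, values in `[0,2]`, gauge and centre-twist invariant). [cite: Luscher1983, §2] -/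
theorem isPhys_polDist [NeZero L] : IsPhys (polDist (L := L)) := by
  have h := isPhys_comp_polDist (L := L) (h := fun t => max 0 (min 2 t)) (by fun_prop) (C := 2)
    (fun t => by
      rw [abs_le]; constructor
      · linarith [le_max_left 0 (min 2 t)]
      · exact max_le (by norm_num) (min_le_left _ _))
  have e : (fun U : GaugeConfig 3 L SU2 => max 0 (min 2 (polDist U))) = polDist := funext fun U => by
    rw [min_eq_right (polDist_le_two U), max_eq_right (polDist_nonneg U)]
  rw [e] at h; exact h

/-- `polDist ∘ S` is physical. [folklore] -/
theorem isPhys_polDist_swap [NeZero L] : IsPhys (fun U : GaugeConfig 3 L SU2 => polDist (configPerm (Equiv.swap (0 : Fin 3) 1) U)) :=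
  isPhys_polDist.comp_configPerm (Equiv.swap (0 : Fin 3) 1)

/-- ★ **The sign witness is physical**: `U ↦ sign(polDist U − polDist (S U))` is measurable, bounded, gauge and centre-twist invariant.
[cite: Luscher1983, §2] -/
theorem isPhys_signWitness [NeZero L] :
    IsPhys (fun U : GaugeConfig 3 L SU2 => Real.sign (polDist U - polDist (configPerm (Equiv.swap (0 : Fin 3) 1) U))) where
  measurable := Literature.Analysis.FunctionSpaces.BMOInv.measurable_real_sign.comp (isPhys_polDist.measurable.sub isPhys_polDist_swap.measurable)
  bounded := ⟨1, fun U => Literature.Analysis.FunctionSpaces.BMOInv.abs_real_sign_le_one _⟩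
  gaugeInv := fun g U => by
    simp only [isPhys_polDist.gaugeInv g U, isPhys_polDist_swap.gaugeInv g U]
  zeroFlux := fun k z hz U => by
    simp only [isPhys_polDist.zeroFlux k z hz U, isPhys_polDist_swap.zeroFlux k z hz U]

/-- `|O| ≤ 1`. [folklore] -/
theorem abs_signWitness_le_one (U : GaugeConfig 3 L SU2) :
    |Real.sign (polDist U - polDist (configPerm (Equiv.swap (0 : Fin 3) 1) U))| ≤ 1 :=
  Literature.Analysis.FunctionSpaces.BMOInv.abs_real_sign_le_one _

/-- ★ **The sign witness is swap-odd**: `O (S U) = − O U` (`S² = 1`). [folklore] -/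
theorem signWitness_swap [NeZero L] (U : GaugeConfig 3 L SU2) :
    Real.sign (polDist (configPerm (Equiv.swap (0 : Fin 3) 1) U) -
        polDist (configPerm (Equiv.swap (0 : Fin 3) 1) (configPerm (Equiv.swap (0 : Fin 3) 1) U))) =
      -Real.sign (polDist U - polDist (configPerm (Equiv.swap (0 : Fin 3) 1) U)) := by
  rw [TT.configPerm_swap_swap, ← Real.sign_neg, neg_sub]

/-! ## §2 The pointwise persistence inequality -/

/-- `polDist ∘ S` is `L·t`-Lipschitz along pairs all of whose links are `t`-close (the swapped configuration reads the same links, permuted). [folklore] -/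
theorem abs_polDist_swap_sub_le_of_forall (U V : GaugeConfig 3 L SU2) {t : ℝ}
    (h : ∀ e, frobNorm ((U e : Matrix (Fin 2) (Fin 2) ℂ) - (V e : Matrix (Fin 2) (Fin 2) ℂ)) ≤ t) :
    |polDist (configPerm (Equiv.swap (0 : Fin 3) 1) U) - polDist (configPerm (Equiv.swap (0 : Fin 3) 1) V)| ≤ L * t :=
  abs_polDist_sub_le_of_forall _ _ fun j _ => by rw [configPerm_apply, configPerm_apply]; exact h _

/-- **Persistence on the good event**: if `|polDist U − polDist (S U)| > 2Lt` and every link of `V` is `t`-close to that of `U`, then `O U · O V = 1`.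
[cite: MadrasSokal1988, §2] -/
theorem signWitness_mul_eq_one (U V : GaugeConfig 3 L SU2) {t : ℝ}
    (hfar : 2 * L * t < |polDist U - polDist (configPerm (Equiv.swap (0 : Fin 3) 1) U)|)
    (hclose : ∀ e, frobNorm ((U e : Matrix (Fin 2) (Fin 2) ℂ) - (V e : Matrix (Fin 2) (Fin 2) ℂ)) ≤ t) :
    Real.sign (polDist U - polDist (configPerm (Equiv.swap (0 : Fin 3) 1) U)) *
      Real.sign (polDist V - polDist (configPerm (Equiv.swap (0 : Fin 3) 1) V)) = 1 := by
  have h1 := abs_polDist_sub_le_of_forall U V fun j _ => hclose (lineEdge L j)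
  have h2 := abs_polDist_swap_sub_le_of_forall U V hclose
  refine real_sign_mul_sign_eq_one (d := 2 * L * t) ?_ hfar
  calc |polDist U - polDist (configPerm (Equiv.swap (0 : Fin 3) 1) U) - (polDist V - polDist (configPerm (Equiv.swap (0 : Fin 3) 1) V))|
      = |(polDist U - polDist V) - (polDist (configPerm (Equiv.swap (0 : Fin 3) 1) U) - polDist (configPerm (Equiv.swap (0 : Fin 3) 1) V))| := by
        ring_nf
    _ ≤ |polDist U - polDist V| + |polDist (configPerm (Equiv.swap (0 : Fin 3) 1) U) - polDist (configPerm (Equiv.swap (0 : Fin 3) 1) V)| :=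
        abs_sub _ _
    _ ≤ L * t + L * t := add_le_add h1 h2
    _ = 2 * L * t := by ring

/-- ★ **Pointwise persistence inequality**: for all `U, V` and `t`,
`O U · O V ≥ 1 − 2·𝟙[|polDist U − polDist (S U)| ≤ 2Lt] − 2·𝟙[∃ e, ‖U_e − V_e‖_F > t]`. [cite: MadrasSokal1988, §2] -/
theorem one_sub_le_signWitness_mul (U V : GaugeConfig 3 L SU2) (t : ℝ) :
    1 - 2 * Set.indicator {W : GaugeConfig 3 L SU2 | |polDist W - polDist (configPerm (Equiv.swap (0 : Fin 3) 1) W)| ≤ 2 * L * t} (fun _ => (1 : ℝ)) U -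
        2 * Set.indicator {p : GaugeConfig 3 L SU2 × GaugeConfig 3 L SU2 |
            ∃ e, t < frobNorm ((p.1 e : Matrix (Fin 2) (Fin 2) ℂ) - (p.2 e : Matrix (Fin 2) (Fin 2) ℂ))} (fun _ => (1 : ℝ)) (U, V) ≤
      Real.sign (polDist U - polDist (configPerm (Equiv.swap (0 : Fin 3) 1) U)) *
        Real.sign (polDist V - polDist (configPerm (Equiv.swap (0 : Fin 3) 1) V)) := by
  have hprod : -1 ≤ Real.sign (polDist U - polDist (configPerm (Equiv.swap (0 : Fin 3) 1) U)) *
      Real.sign (polDist V - polDist (configPerm (Equiv.swap (0 : Fin 3) 1) V)) := by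
    have h := abs_mul (Real.sign (polDist U - polDist (configPerm (Equiv.swap (0 : Fin 3) 1) U)))
      (Real.sign (polDist V - polDist (configPerm (Equiv.swap (0 : Fin 3) 1) V)))
    have h1 := abs_signWitness_le_one U
    have h2 := abs_signWitness_le_one V
    have h3 : |Real.sign (polDist U - polDist (configPerm (Equiv.swap (0 : Fin 3) 1) U)) *
        Real.sign (polDist V - polDist (configPerm (Equiv.swap (0 : Fin 3) 1) V))| ≤ 1 := by
      rw [h]; exact mul_le_one₀ h1 (abs_nonneg _) h2
    exact (abs_le.1 h3).1
  by_cases hs : U ∈ {W : GaugeConfig 3 L SU2 | |polDist W - polDist (configPerm (Equiv.swap (0 : Fin 3) 1) W)| ≤ 2 * L * t}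
  · rw [Set.indicator_of_mem hs]
    have h0 : 0 ≤ Set.indicator {p : GaugeConfig 3 L SU2 × GaugeConfig 3 L SU2 |
        ∃ e, t < frobNorm ((p.1 e : Matrix (Fin 2) (Fin 2) ℂ) - (p.2 e : Matrix (Fin 2) (Fin 2) ℂ))} (fun _ => (1 : ℝ)) (U, V) :=
      Set.indicator_nonneg (fun _ _ => zero_le_one) _
    linarith
  rw [Set.indicator_of_notMem hs]
  by_cases hd : (U, V) ∈ {p : GaugeConfig 3 L SU2 × GaugeConfig 3 L SU2 |
      ∃ e, t < frobNorm ((p.1 e : Matrix (Fin 2) (Fin 2) ℂ) - (p.2 e : Matrix (Fin 2) (Fin 2) ℂ))}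
  · rw [Set.indicator_of_mem hd]; linarith
  rw [Set.indicator_of_notMem hd]
  have hfar : 2 * L * t < |polDist U - polDist (configPerm (Equiv.swap (0 : Fin 3) 1) U)| := not_le.1 hs
  have hclose : ∀ e, frobNorm ((U e : Matrix (Fin 2) (Fin 2) ℂ) - (V e : Matrix (Fin 2) (Fin 2) ℂ)) ≤ t := fun e =>
    not_lt.1 fun h => hd ⟨e, h⟩
  rw [signWitness_mul_eq_one U V hfar hclose]; norm_num

/-! ## §3 The kernel on the far event -/

/-- **The far event is exponentially suppressed by the transfer kernel**: `K_β(U,V)·𝟙[∃ e, ‖U_e − V_e‖_F > t] ≤ e^{β(2|E| − t²/2)}` (`β, t ≥ 0`).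
[cite: SeilerLNP1982, §3] -/
theorem transferKernel_mul_indicator_far_le [NeZero L] {β : ℝ} (hβ : 0 ≤ β) {t : ℝ} (ht : 0 ≤ t) (U V : GaugeConfig 3 L SU2) :
    transferKernel su2Rep β U V * Set.indicator {p : GaugeConfig 3 L SU2 × GaugeConfig 3 L SU2 |
        ∃ e, t < frobNorm ((p.1 e : Matrix (Fin 2) (Fin 2) ℂ) - (p.2 e : Matrix (Fin 2) (Fin 2) ℂ))} (fun _ => (1 : ℝ)) (U, V) ≤
      Real.exp (β * (2 * (Fintype.card (Edge 3 L) : ℝ) - t ^ 2 / 2)) := by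
  by_cases hd : (U, V) ∈ {p : GaugeConfig 3 L SU2 × GaugeConfig 3 L SU2 |
      ∃ e, t < frobNorm ((p.1 e : Matrix (Fin 2) (Fin 2) ℂ) - (p.2 e : Matrix (Fin 2) (Fin 2) ℂ))}
  · rw [Set.indicator_of_mem hd, mul_one]
    obtain ⟨e, he⟩ := hd
    exact transferKernel_le_of_far_link hβ e ht he.le
  · rw [Set.indicator_of_notMem hd, mul_zero]; exact (Real.exp_pos _).le

/-- The far event is a measurable set (finite union of open conditions in a continuous function). [folklore] -/
theorem measurableSet_far [NeZero L] (t : ℝ) :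
    MeasurableSet {p : GaugeConfig 3 L SU2 × GaugeConfig 3 L SU2 |
        ∃ e, t < frobNorm ((p.1 e : Matrix (Fin 2) (Fin 2) ℂ) - (p.2 e : Matrix (Fin 2) (Fin 2) ℂ))} := by
  haveI : SecondCountableTopology SU2 := secondCountableTopology_su2
  have h : {p : GaugeConfig 3 L SU2 × GaugeConfig 3 L SU2 |
      ∃ e, t < frobNorm ((p.1 e : Matrix (Fin 2) (Fin 2) ℂ) - (p.2 e : Matrix (Fin 2) (Fin 2) ℂ))} =
      ⋃ e : Edge 3 L, {p | t < frobNorm ((p.1 e : Matrix (Fin 2) (Fin 2) ℂ) - (p.2 e : Matrix (Fin 2) (Fin 2) ℂ))} := by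
    ext p; simp
  rw [h]
  refine MeasurableSet.iUnion fun e => ?_
  have hc : Continuous fun p : GaugeConfig 3 L SU2 × GaugeConfig 3 L SU2 =>
      frobNorm ((p.1 e : Matrix (Fin 2) (Fin 2) ℂ) - (p.2 e : Matrix (Fin 2) (Fin 2) ℂ)) :=
    continuous_frobNorm'.comp ((continuous_subtype_val.comp ((continuous_apply e).comp continuous_fst)).sub
      (continuous_subtype_val.comp ((continuous_apply e).comp continuous_snd)))
  exact (isOpen_lt continuous_const hc).measurableSet

/-- The strip `{|polDist − polDist∘S| ≤ w}` is a measurable set. [folklore] -/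
theorem measurableSet_strip [NeZero L] (w : ℝ) :
    MeasurableSet {W : GaugeConfig 3 L SU2 | |polDist W - polDist (configPerm (Equiv.swap (0 : Fin 3) 1) W)| ≤ w} :=
  measurableSet_le ((isPhys_polDist.measurable.sub isPhys_polDist_swap.measurable).abs) measurable_const

end Summit.QuantumFields.YangMills.Theorems.FemtoTransferGap.FlatSheet

end
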